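import Summits.AtomisticToContinuum.Crystallization.Theorems.FreeSplittingCertificatesStrictSplittingRuleP1ElemOct

/-!
# `StrictSplittingRule` (stmt-AtomisticToContinuum-12560): the TETRAHEDRON receipts lemma APPLIED to the P1 interpolant — all four tetrahedron types of the honeycomb (P1 interpolant object, part 12)

Route `FreeSplittingCertificates`, crux r3 `StrictSplittingRule` (H12⋆ = `stub_coreJointCoercive`), unit b2b-freesplit-B gen 20.
VALUE = the element algebra of the transfer (`fpRec_le_tet`, gen 12) INSTANTIATED on the interpolant object, completing (with part 11) the
receipts inequality for EVERY cell of the honeycomb: for the far-ledger field `v = p1Disp a h U b₀ A` and every cube `n`,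
`min(a⁴,a²h²,h⁴)·fpRec(G_{(n,π)}) ≤ 16·Σ_{6 edges e} ⟪y_e, v(head e) − v(tail e)⟫²` for the corner tetrahedra `π = 0, 1` of even cubes
(`p1TetEven0_receipts`, `p1TetEven1_receipts`: edge labels `hcpTetIdx`) and of odd cubes (`p1TetOdd0_receipts`, `p1TetOdd1_receipts`: the
MIRRORED edge labels `(0,1,0),(0,1,−1),(−1,−1,0),(0,0,1),(−1,0,0),(−1,0,−1)`, reduced to `fpRec_le_tet` by conjugating the gradient with the
mirror `diag(1,−1,1)`, under which `fpRec` is invariant and the `hcpTetIdx` vectors go to ± the mirrored ones: `fpRec_le_tetMirror`).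
Item (2') of HOME FAR-LEMMA-SPEC §16 (c) (receipts side), tetrahedra.  NOT a proof of H12⋆, NOT summit progress.  [folklore]
-/

noncomputable section

open Set Function
open scoped BigOperators

namespace Summit.AtomisticToContinuum.Crystallization.Theorems.StrictSplittingRuleBirth

open Literature.MathematicalPhysics.StatisticalMechanics
open Summit.AtomisticToContinuum.Crystallization.Theorems.PalmUnimodularRigidity.LayeredLawsSelectHcp
open Summit.AtomisticToContinuum.Crystallization.Theorems.PhononStabilityCWC.Cert (inner_fin3)

/-! ## The edge quadratic form -/

/-- The edge quadratic form `yᵀ·G·y` (the summand of `fpTet` before squaring). -/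
def p1Quad (G : Fin 3 → Fin 3 → ℝ) (y : EuclideanSpace ℝ (Fin 3)) : ℝ :=
  G 0 0 * y 0 ^ 2 + G 1 1 * y 1 ^ 2 + G 2 2 * y 2 ^ 2 + 2 * ((G 0 1 + G 1 0) / 2) * (y 0 * y 1) +
    2 * ((G 0 2 + G 2 0) / 2) * (y 0 * y 2) + 2 * ((G 1 2 + G 2 1) / 2) * (y 1 * y 2)

/-- `fpTet` is the sum of the squared edge forms over `hcpTetIdx`. -/
theorem fpTet_eq_sum_p1Quad (a h : ℝ) (G : Fin 3 → Fin 3 → ℝ) :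
    fpTet a h G = p1Quad G (hcpSite a h (0, 1, 0)) ^ 2 + (p1Quad G (hcpSite a h (0, 0, 1)) ^ 2 +
      (p1Quad G (hcpSite a h (1, 0, 0)) ^ 2 + (p1Quad G (hcpSite a h (0, 1, -1)) ^ 2 +
        (p1Quad G (hcpSite a h (1, -1, 0)) ^ 2 + p1Quad G (hcpSite a h (1, 0, -1)) ^ 2)))) := by
  rw [fpTet, hcpTet_sum_expand]
  rfl

/-- **The edge form is the stretch**: if `(w_h − w_t)_k = Σ_j G_{kj} (y_e)_j` then `y_eᵀ G y_e = ⟪y_e, w_h − w_t⟫`. -/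
theorem p1Quad_eq_inner {a h : ℝ} {G : Fin 3 → Fin 3 → ℝ} {d : ℤ × ℤ × ℤ} {wh wt : EuclideanSpace ℝ (Fin 3)}
    (hs : ∀ k, (wh - wt) k = G k 0 * hcpSite a h d 0 + G k 1 * hcpSite a h d 1 + G k 2 * hcpSite a h d 2) :
    p1Quad G (hcpSite a h d) = inner ℝ (hcpSite a h d) (wh - wt) := by
  rw [inner_fin3, hs 0, hs 1, hs 2, p1Quad]
  ring

/-! ## The mirrored tetrahedron -/

/-- The mirror sign vector `(1, −1, 1)` (reflection `y₁ ↦ −y₁`, a symmetry of each close-packed layer exchanging the shift `s` with `a₁ − s`). -/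
def p1Mir : Fin 3 → ℝ := ![1, -1, 1]

/-- `fpRec` is invariant under conjugation by the mirror. -/
theorem fpRec_mirror (G : Fin 3 → Fin 3 → ℝ) : fpRec (fun i j => p1Mir i * p1Mir j * G i j) = fpRec G := by
  simp [fpRec, fpTr, fpSymSq, p1Mir]
  ring

/-- Mirror image of the edge `(0, 1, 0)` is (±) the edge `(0, 1, 0)`. -/
theorem p1Quad_mirror_m010 (a h : ℝ) (G : Fin 3 → Fin 3 → ℝ) :
    p1Quad (fun i j => p1Mir i * p1Mir j * G i j) (hcpSite a h (0, 1, 0)) = p1Quad G (hcpSite a h (0, 1, 0)) := by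
  simp [p1Quad, p1Mir, hcpSite_apply_zero, hcpSite_apply_one, hcpSite_apply_two]

/-- Mirror image of the edge `(0, 0, 1)` is (±) the edge `(0, 1, -1)`. -/
theorem p1Quad_mirror_m001 (a h : ℝ) (G : Fin 3 → Fin 3 → ℝ) :
    p1Quad (fun i j => p1Mir i * p1Mir j * G i j) (hcpSite a h (0, 0, 1)) = p1Quad G (hcpSite a h (0, 1, -1)) := by
  simp [p1Quad, p1Mir, hcpSite_apply_zero, hcpSite_apply_one, hcpSite_apply_two]
  ring

/-- Mirror image of the edge `(1, 0, 0)` is (±) the edge `(-1, -1, 0)`. -/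
theorem p1Quad_mirror_m100 (a h : ℝ) (G : Fin 3 → Fin 3 → ℝ) :
    p1Quad (fun i j => p1Mir i * p1Mir j * G i j) (hcpSite a h (1, 0, 0)) = p1Quad G (hcpSite a h (-1, -1, 0)) := by
  simp [p1Quad, p1Mir, hcpSite_apply_zero, hcpSite_apply_one, hcpSite_apply_two, haggLabel_alternating]
  ring

/-- Mirror image of the edge `(0, 1, -1)` is (±) the edge `(0, 0, 1)`. -/
theorem p1Quad_mirror_m01n1 (a h : ℝ) (G : Fin 3 → Fin 3 → ℝ) :
    p1Quad (fun i j => p1Mir i * p1Mir j * G i j) (hcpSite a h (0, 1, -1)) = p1Quad G (hcpSite a h (0, 0, 1)) := by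
  simp [p1Quad, p1Mir, hcpSite_apply_zero, hcpSite_apply_one, hcpSite_apply_two]
  ring

/-- Mirror image of the edge `(1, -1, 0)` is (±) the edge `(-1, 0, 0)`. -/
theorem p1Quad_mirror_m1n10 (a h : ℝ) (G : Fin 3 → Fin 3 → ℝ) :
    p1Quad (fun i j => p1Mir i * p1Mir j * G i j) (hcpSite a h (1, -1, 0)) = p1Quad G (hcpSite a h (-1, 0, 0)) := by
  simp [p1Quad, p1Mir, hcpSite_apply_zero, hcpSite_apply_one, hcpSite_apply_two, haggLabel_alternating]
  ring

/-- Mirror image of the edge `(1, 0, -1)` is (±) the edge `(-1, 0, -1)`. -/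
theorem p1Quad_mirror_m10n1 (a h : ℝ) (G : Fin 3 → Fin 3 → ℝ) :
    p1Quad (fun i j => p1Mir i * p1Mir j * G i j) (hcpSite a h (1, 0, -1)) = p1Quad G (hcpSite a h (-1, 0, -1)) := by
  simp [p1Quad, p1Mir, hcpSite_apply_zero, hcpSite_apply_one, hcpSite_apply_two, haggLabel_alternating]
  ring

/-- **The mirrored tetrahedron receipts inequality**: `min(a⁴,a²h²,h⁴)·fpRec G ≤ 16·Σ` over the mirrored edge labels — from `fpRec_le_tet`
applied to the mirror-conjugated gradient. -/
theorem fpRec_le_tetMirror (a h : ℝ) (G : Fin 3 → Fin 3 → ℝ) :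
    min (min (a ^ 4) (a ^ 2 * h ^ 2)) (h ^ 4) * fpRec G ≤
      16 * (p1Quad G (hcpSite a h (0, 1, 0)) ^ 2 + (p1Quad G (hcpSite a h (0, 1, -1)) ^ 2 +
        (p1Quad G (hcpSite a h (-1, -1, 0)) ^ 2 + (p1Quad G (hcpSite a h (0, 0, 1)) ^ 2 +
          (p1Quad G (hcpSite a h (-1, 0, 0)) ^ 2 + p1Quad G (hcpSite a h (-1, 0, -1)) ^ 2))))) := by
  have h := fpRec_le_tet a h (fun i j => p1Mir i * p1Mir j * G i j)
  rw [fpRec_mirror, fpTet_eq_sum_p1Quad, p1Quad_mirror_m010, p1Quad_mirror_m001, p1Quad_mirror_m100, p1Quad_mirror_m01n1,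
    p1Quad_mirror_m1n10, p1Quad_mirror_m10n1] at h
  exact h

/-- In-layer translations are additive for every base site: `y_{c + (0,i,j)} = y_c + y_{(0,i,j)}`. -/
theorem hcpSite_add_layer0 (a h : ℝ) (c : ℤ × ℤ × ℤ) (i j : ℤ) (k : Fin 3) :
    hcpSite a h (c + (0, i, j)) k = hcpSite a h c k + hcpSite a h (0, i, j) k := by
  have h0 : haggLabel alternatingHagg 0 = 0 := by rw [haggLabel_alternating, if_pos (by decide)]
  fin_cases k
  · simp only [Fin.zero_eta, hcpSite_apply_zero, Prod.fst_add, Prod.snd_add, add_zero, h0]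
    push_cast; ring
  · simp only [Fin.mk_one, hcpSite_apply_one, Prod.fst_add, Prod.snd_add, add_zero, h0]
    push_cast; ring
  · simp only [Fin.reduceFinMk, hcpSite_apply_two, Prod.fst_add, add_zero]
    push_cast; ring

/-! ## The four tetrahedron types -/

/-- **Tetrahedron receipts for the interpolant, EVEN cube, piece 0** (vertices `n+(0, 0, 0), n+(1, 0, 0), n+(0, 1, 0), n+(0, 0, 1)`): the cell gradient's
receipts form is paid by the six edge stretches of the far-ledger field.  NOT a proof of H12⋆, NOT summit progress. -/
theorem p1TetEven0_receipts {a h : ℝ} (ha : a ≠ 0) (hh : h ≠ 0) (U : ℤ × ℤ × ℤ → (Fin 3 → ℝ)) (b₀ : Fin 3 → ℝ) (A : Fin 3 → Fin 3 → ℝ)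
    (n : ℤ × ℤ × ℤ) (hn : p1Par n = true) :
    min (min (a ^ 4) (a ^ 2 * h ^ 2)) (h ^ 4) * fpRec (p1CellGradT a h U A (n, 0)) ≤
      16 * (inner ℝ (hcpSite a h (0, 1, 0)) (p1DispSite a h U b₀ A (n + (0, 1, 0)) - p1DispSite a h U b₀ A n) ^ 2 + (inner ℝ (hcpSite a h (0, 0, 1)) (p1DispSite a h U b₀ A (n + (0, 0, 1)) - p1DispSite a h U b₀ A n) ^ 2 +
      (inner ℝ (hcpSite a h (1, 0, 0)) (p1DispSite a h U b₀ A (n + (1, 0, 0)) - p1DispSite a h U b₀ A n) ^ 2 + (inner ℝ (hcpSite a h (0, 1, -1)) (p1DispSite a h U b₀ A (n + (0, 1, 0)) - p1DispSite a h U b₀ A (n + (0, 0, 1))) ^ 2 +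
        (inner ℝ (hcpSite a h (1, -1, 0)) (p1DispSite a h U b₀ A (n + (1, 0, 0)) - p1DispSite a h U b₀ A (n + (0, 1, 0))) ^ 2 + inner ℝ (hcpSite a h (1, 0, -1)) (p1DispSite a h U b₀ A (n + (1, 0, 0)) - p1DispSite a h U b₀ A (n + (0, 0, 1))) ^ 2))))) := by
  have hn' : decide (Even n.1) = true := hn
  have hne : Even n.1 := of_decide_eq_true hn'
  have hd0 : ∀ k, hcpSite a h (n + (0, 1, 0)) k - hcpSite a h n k = hcpSite a h (0, 1, 0) k := by
    intro k
    have hb : Even (n : ℤ × ℤ × ℤ).1 := hne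
    have : ((n + (0, 1, 0)) : ℤ × ℤ × ℤ) = n + (0, 1, 0) := by ext <;> simp
    rw [this, hcpSite_add_of_even a h hb, PiLp.add_apply]
    ring
  have h0 := p1DispSite_vertex_sub ha hh U b₀ A (n, 0) (m := 2) (m' := 0) (v := (n + (0, 1, 0))) (w := n)
    (by simp [hn, p1VertOff]) (by simp [hn, p1VertOff]) hd0
  have hd1 : ∀ k, hcpSite a h (n + (0, 0, 1)) k - hcpSite a h n k = hcpSite a h (0, 0, 1) k := by
    intro k
    have hb : Even (n : ℤ × ℤ × ℤ).1 := hne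
    have : ((n + (0, 0, 1)) : ℤ × ℤ × ℤ) = n + (0, 0, 1) := by ext <;> simp
    rw [this, hcpSite_add_of_even a h hb, PiLp.add_apply]
    ring
  have h1 := p1DispSite_vertex_sub ha hh U b₀ A (n, 0) (m := 3) (m' := 0) (v := (n + (0, 0, 1))) (w := n)
    (by simp [hn, p1VertOff]) (by simp [hn, p1VertOff]) hd1
  have hd2 : ∀ k, hcpSite a h (n + (1, 0, 0)) k - hcpSite a h n k = hcpSite a h (1, 0, 0) k := by
    intro k
    have hb : Even (n : ℤ × ℤ × ℤ).1 := hne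
    have : ((n + (1, 0, 0)) : ℤ × ℤ × ℤ) = n + (1, 0, 0) := by ext <;> simp
    rw [this, hcpSite_add_of_even a h hb, PiLp.add_apply]
    ring
  have h2 := p1DispSite_vertex_sub ha hh U b₀ A (n, 0) (m := 1) (m' := 0) (v := (n + (1, 0, 0))) (w := n)
    (by simp [hn, p1VertOff]) (by simp [hn, p1VertOff]) hd2
  have hd3 : ∀ k, hcpSite a h (n + (0, 1, 0)) k - hcpSite a h (n + (0, 0, 1)) k = hcpSite a h (0, 1, -1) k := by
    intro k
    have hb : Even ((n + (0, 0, 1)) : ℤ × ℤ × ℤ).1 := by show Even (n.1 + 0); simpa using hne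
    have : ((n + (0, 1, 0)) : ℤ × ℤ × ℤ) = (n + (0, 0, 1)) + (0, 1, -1) := by ext <;> simp
    rw [this, hcpSite_add_of_even a h hb, PiLp.add_apply]
    ring
  have h3 := p1DispSite_vertex_sub ha hh U b₀ A (n, 0) (m := 2) (m' := 3) (v := (n + (0, 1, 0))) (w := (n + (0, 0, 1)))
    (by simp [hn, p1VertOff]) (by simp [hn, p1VertOff]) hd3
  have hd4 : ∀ k, hcpSite a h (n + (1, 0, 0)) k - hcpSite a h (n + (0, 1, 0)) k = hcpSite a h (1, -1, 0) k := by
    intro k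
    have hb : Even ((n + (0, 1, 0)) : ℤ × ℤ × ℤ).1 := by show Even (n.1 + 0); simpa using hne
    have : ((n + (1, 0, 0)) : ℤ × ℤ × ℤ) = (n + (0, 1, 0)) + (1, -1, 0) := by ext <;> simp
    rw [this, hcpSite_add_of_even a h hb, PiLp.add_apply]
    ring
  have h4 := p1DispSite_vertex_sub ha hh U b₀ A (n, 0) (m := 1) (m' := 2) (v := (n + (1, 0, 0))) (w := (n + (0, 1, 0)))
    (by simp [hn, p1VertOff]) (by simp [hn, p1VertOff]) hd4
  have hd5 : ∀ k, hcpSite a h (n + (1, 0, 0)) k - hcpSite a h (n + (0, 0, 1)) k = hcpSite a h (1, 0, -1) k := by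
    intro k
    have hb : Even ((n + (0, 0, 1)) : ℤ × ℤ × ℤ).1 := by show Even (n.1 + 0); simpa using hne
    have : ((n + (1, 0, 0)) : ℤ × ℤ × ℤ) = (n + (0, 0, 1)) + (1, 0, -1) := by ext <;> simp
    rw [this, hcpSite_add_of_even a h hb, PiLp.add_apply]
    ring
  have h5 := p1DispSite_vertex_sub ha hh U b₀ A (n, 0) (m := 1) (m' := 3) (v := (n + (1, 0, 0))) (w := (n + (0, 0, 1)))
    (by simp [hn, p1VertOff]) (by simp [hn, p1VertOff]) hd5
  have key := fpRec_le_tet a h (p1CellGradT a h U A (n, 0))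
  rw [fpTet_eq_sum_p1Quad, p1Quad_eq_inner h0, p1Quad_eq_inner h1, p1Quad_eq_inner h2, p1Quad_eq_inner h3, p1Quad_eq_inner h4, p1Quad_eq_inner h5] at key
  exact key

/-- **Tetrahedron receipts for the interpolant, EVEN cube, piece 1** (vertices `n+(1, 1, 1), n+(0, 1, 1), n+(1, 0, 1), n+(1, 1, 0)`): the cell gradient's
receipts form is paid by the six edge stretches of the far-ledger field.  NOT a proof of H12⋆, NOT summit progress. -/
theorem p1TetEven1_receipts {a h : ℝ} (ha : a ≠ 0) (hh : h ≠ 0) (U : ℤ × ℤ × ℤ → (Fin 3 → ℝ)) (b₀ : Fin 3 → ℝ) (A : Fin 3 → Fin 3 → ℝ)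
    (n : ℤ × ℤ × ℤ) (hn : p1Par n = true) :
    min (min (a ^ 4) (a ^ 2 * h ^ 2)) (h ^ 4) * fpRec (p1CellGradT a h U A (n, 1)) ≤
      16 * (inner ℝ (hcpSite a h (0, 1, 0)) (p1DispSite a h U b₀ A (n + (1, 1, 1)) - p1DispSite a h U b₀ A (n + (1, 0, 1))) ^ 2 + (inner ℝ (hcpSite a h (0, 0, 1)) (p1DispSite a h U b₀ A (n + (1, 1, 1)) - p1DispSite a h U b₀ A (n + (1, 1, 0))) ^ 2 +
      (inner ℝ (hcpSite a h (1, 0, 0)) (p1DispSite a h U b₀ A (n + (1, 1, 1)) - p1DispSite a h U b₀ A (n + (0, 1, 1))) ^ 2 + (inner ℝ (hcpSite a h (0, 1, -1)) (p1DispSite a h U b₀ A (n + (1, 1, 0)) - p1DispSite a h U b₀ A (n + (1, 0, 1))) ^ 2 +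
        (inner ℝ (hcpSite a h (1, -1, 0)) (p1DispSite a h U b₀ A (n + (1, 0, 1)) - p1DispSite a h U b₀ A (n + (0, 1, 1))) ^ 2 + inner ℝ (hcpSite a h (1, 0, -1)) (p1DispSite a h U b₀ A (n + (1, 1, 0)) - p1DispSite a h U b₀ A (n + (0, 1, 1))) ^ 2))))) := by
  have hn' : decide (Even n.1) = true := hn
  have hne : Even n.1 := of_decide_eq_true hn'
  have hd0 : ∀ k, hcpSite a h (n + (1, 1, 1)) k - hcpSite a h (n + (1, 0, 1)) k = hcpSite a h (0, 1, 0) k := by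
    intro k
    have : ((n + (1, 1, 1)) : ℤ × ℤ × ℤ) = (n + (1, 0, 1)) + (0, 1, 0) := by ext <;> simp
    rw [this, hcpSite_add_layer0]
    ring
  have h0 := p1DispSite_vertex_sub ha hh U b₀ A (n, 1) (m := 0) (m' := 2) (v := (n + (1, 1, 1))) (w := (n + (1, 0, 1)))
    (by simp [hn, p1VertOff]) (by simp [hn, p1VertOff]) hd0
  have hd1 : ∀ k, hcpSite a h (n + (1, 1, 1)) k - hcpSite a h (n + (1, 1, 0)) k = hcpSite a h (0, 0, 1) k := by
    intro k
    have : ((n + (1, 1, 1)) : ℤ × ℤ × ℤ) = (n + (1, 1, 0)) + (0, 0, 1) := by ext <;> simp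
    rw [this, hcpSite_add_layer0]
    ring
  have h1 := p1DispSite_vertex_sub ha hh U b₀ A (n, 1) (m := 0) (m' := 3) (v := (n + (1, 1, 1))) (w := (n + (1, 1, 0)))
    (by simp [hn, p1VertOff]) (by simp [hn, p1VertOff]) hd1
  have hd2 : ∀ k, hcpSite a h (n + (1, 1, 1)) k - hcpSite a h (n + (0, 1, 1)) k = hcpSite a h (1, 0, 0) k := by
    intro k
    have hb : Even ((n + (0, 1, 1)) : ℤ × ℤ × ℤ).1 := by show Even (n.1 + 0); simpa using hne
    have : ((n + (1, 1, 1)) : ℤ × ℤ × ℤ) = (n + (0, 1, 1)) + (1, 0, 0) := by ext <;> simp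
    rw [this, hcpSite_add_of_even a h hb, PiLp.add_apply]
    ring
  have h2 := p1DispSite_vertex_sub ha hh U b₀ A (n, 1) (m := 0) (m' := 1) (v := (n + (1, 1, 1))) (w := (n + (0, 1, 1)))
    (by simp [hn, p1VertOff]) (by simp [hn, p1VertOff]) hd2
  have hd3 : ∀ k, hcpSite a h (n + (1, 1, 0)) k - hcpSite a h (n + (1, 0, 1)) k = hcpSite a h (0, 1, -1) k := by
    intro k
    have : ((n + (1, 1, 0)) : ℤ × ℤ × ℤ) = (n + (1, 0, 1)) + (0, 1, -1) := by ext <;> simp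
    rw [this, hcpSite_add_layer0]
    ring
  have h3 := p1DispSite_vertex_sub ha hh U b₀ A (n, 1) (m := 3) (m' := 2) (v := (n + (1, 1, 0))) (w := (n + (1, 0, 1)))
    (by simp [hn, p1VertOff]) (by simp [hn, p1VertOff]) hd3
  have hd4 : ∀ k, hcpSite a h (n + (1, 0, 1)) k - hcpSite a h (n + (0, 1, 1)) k = hcpSite a h (1, -1, 0) k := by
    intro k
    have hb : Even ((n + (0, 1, 1)) : ℤ × ℤ × ℤ).1 := by show Even (n.1 + 0); simpa using hne
    have : ((n + (1, 0, 1)) : ℤ × ℤ × ℤ) = (n + (0, 1, 1)) + (1, -1, 0) := by ext <;> simp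
    rw [this, hcpSite_add_of_even a h hb, PiLp.add_apply]
    ring
  have h4 := p1DispSite_vertex_sub ha hh U b₀ A (n, 1) (m := 2) (m' := 1) (v := (n + (1, 0, 1))) (w := (n + (0, 1, 1)))
    (by simp [hn, p1VertOff]) (by simp [hn, p1VertOff]) hd4
  have hd5 : ∀ k, hcpSite a h (n + (1, 1, 0)) k - hcpSite a h (n + (0, 1, 1)) k = hcpSite a h (1, 0, -1) k := by
    intro k
    have hb : Even ((n + (0, 1, 1)) : ℤ × ℤ × ℤ).1 := by show Even (n.1 + 0); simpa using hne
    have : ((n + (1, 1, 0)) : ℤ × ℤ × ℤ) = (n + (0, 1, 1)) + (1, 0, -1) := by ext <;> simp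
    rw [this, hcpSite_add_of_even a h hb, PiLp.add_apply]
    ring
  have h5 := p1DispSite_vertex_sub ha hh U b₀ A (n, 1) (m := 3) (m' := 1) (v := (n + (1, 1, 0))) (w := (n + (0, 1, 1)))
    (by simp [hn, p1VertOff]) (by simp [hn, p1VertOff]) hd5
  have key := fpRec_le_tet a h (p1CellGradT a h U A (n, 1))
  rw [fpTet_eq_sum_p1Quad, p1Quad_eq_inner h0, p1Quad_eq_inner h1, p1Quad_eq_inner h2, p1Quad_eq_inner h3, p1Quad_eq_inner h4, p1Quad_eq_inner h5] at key
  exact key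

/-- **Tetrahedron receipts for the interpolant, ODD cube, piece 0** (vertices `n+(1, 0, 0), n+(0, 0, 0), n+(1, 1, 0), n+(1, 0, 1)`): the cell gradient's
receipts form is paid by the six edge stretches of the far-ledger field.  NOT a proof of H12⋆, NOT summit progress. -/
theorem p1TetOdd0_receipts {a h : ℝ} (ha : a ≠ 0) (hh : h ≠ 0) (U : ℤ × ℤ × ℤ → (Fin 3 → ℝ)) (b₀ : Fin 3 → ℝ) (A : Fin 3 → Fin 3 → ℝ)
    (n : ℤ × ℤ × ℤ) (hn : p1Par n = false) :
    min (min (a ^ 4) (a ^ 2 * h ^ 2)) (h ^ 4) * fpRec (p1CellGradT a h U A (n, 0)) ≤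
      16 * (inner ℝ (hcpSite a h (0, 1, 0)) (p1DispSite a h U b₀ A (n + (1, 1, 0)) - p1DispSite a h U b₀ A (n + (1, 0, 0))) ^ 2 + (inner ℝ (hcpSite a h (0, 1, -1)) (p1DispSite a h U b₀ A (n + (1, 1, 0)) - p1DispSite a h U b₀ A (n + (1, 0, 1))) ^ 2 +
      (inner ℝ (hcpSite a h (-1, -1, 0)) (p1DispSite a h U b₀ A n - p1DispSite a h U b₀ A (n + (1, 1, 0))) ^ 2 + (inner ℝ (hcpSite a h (0, 0, 1)) (p1DispSite a h U b₀ A (n + (1, 0, 1)) - p1DispSite a h U b₀ A (n + (1, 0, 0))) ^ 2 +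
        (inner ℝ (hcpSite a h (-1, 0, 0)) (p1DispSite a h U b₀ A n - p1DispSite a h U b₀ A (n + (1, 0, 0))) ^ 2 + inner ℝ (hcpSite a h (-1, 0, -1)) (p1DispSite a h U b₀ A n - p1DispSite a h U b₀ A (n + (1, 0, 1))) ^ 2))))) := by
  have hn' : decide (Even n.1) = false := hn
  have hno : Odd n.1 := Int.not_even_iff_odd.1 (of_decide_eq_false hn')
  have hd0 : ∀ k, hcpSite a h (n + (1, 1, 0)) k - hcpSite a h (n + (1, 0, 0)) k = hcpSite a h (0, 1, 0) k := by
    intro k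
    have : ((n + (1, 1, 0)) : ℤ × ℤ × ℤ) = (n + (1, 0, 0)) + (0, 1, 0) := by ext <;> simp
    rw [this, hcpSite_add_layer0]
    ring
  have h0 := p1DispSite_vertex_sub ha hh U b₀ A (n, 0) (m := 2) (m' := 0) (v := (n + (1, 1, 0))) (w := (n + (1, 0, 0)))
    (by simp [hn, p1VertOff]) (by simp [hn, p1VertOff]) hd0
  have hd1 : ∀ k, hcpSite a h (n + (1, 1, 0)) k - hcpSite a h (n + (1, 0, 1)) k = hcpSite a h (0, 1, -1) k := by
    intro k
    have : ((n + (1, 1, 0)) : ℤ × ℤ × ℤ) = (n + (1, 0, 1)) + (0, 1, -1) := by ext <;> simp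
    rw [this, hcpSite_add_layer0]
    ring
  have h1 := p1DispSite_vertex_sub ha hh U b₀ A (n, 0) (m := 2) (m' := 3) (v := (n + (1, 1, 0))) (w := (n + (1, 0, 1)))
    (by simp [hn, p1VertOff]) (by simp [hn, p1VertOff]) hd1
  have hd2 : ∀ k, hcpSite a h n k - hcpSite a h (n + (1, 1, 0)) k = hcpSite a h (-1, -1, 0) k := by
    intro k
    have hc : Odd (n : ℤ × ℤ × ℤ).1 := by show Odd (n.1); simpa using hno
    have : ((n + (1, 1, 0)) : ℤ × ℤ × ℤ) = n - (-1, -1, 0) := by ext <;> simp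
    rw [this, hcpSite_sub_of_odd a h hc, PiLp.sub_apply]
    ring
  have h2 := p1DispSite_vertex_sub ha hh U b₀ A (n, 0) (m := 1) (m' := 2) (v := n) (w := (n + (1, 1, 0)))
    (by simp [hn, p1VertOff]) (by simp [hn, p1VertOff]) hd2
  have hd3 : ∀ k, hcpSite a h (n + (1, 0, 1)) k - hcpSite a h (n + (1, 0, 0)) k = hcpSite a h (0, 0, 1) k := by
    intro k
    have : ((n + (1, 0, 1)) : ℤ × ℤ × ℤ) = (n + (1, 0, 0)) + (0, 0, 1) := by ext <;> simp
    rw [this, hcpSite_add_layer0]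
    ring
  have h3 := p1DispSite_vertex_sub ha hh U b₀ A (n, 0) (m := 3) (m' := 0) (v := (n + (1, 0, 1))) (w := (n + (1, 0, 0)))
    (by simp [hn, p1VertOff]) (by simp [hn, p1VertOff]) hd3
  have hd4 : ∀ k, hcpSite a h n k - hcpSite a h (n + (1, 0, 0)) k = hcpSite a h (-1, 0, 0) k := by
    intro k
    have hc : Odd (n : ℤ × ℤ × ℤ).1 := by show Odd (n.1); simpa using hno
    have : ((n + (1, 0, 0)) : ℤ × ℤ × ℤ) = n - (-1, 0, 0) := by ext <;> simp
    rw [this, hcpSite_sub_of_odd a h hc, PiLp.sub_apply]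
    ring
  have h4 := p1DispSite_vertex_sub ha hh U b₀ A (n, 0) (m := 1) (m' := 0) (v := n) (w := (n + (1, 0, 0)))
    (by simp [hn, p1VertOff]) (by simp [hn, p1VertOff]) hd4
  have hd5 : ∀ k, hcpSite a h n k - hcpSite a h (n + (1, 0, 1)) k = hcpSite a h (-1, 0, -1) k := by
    intro k
    have hc : Odd (n : ℤ × ℤ × ℤ).1 := by show Odd (n.1); simpa using hno
    have : ((n + (1, 0, 1)) : ℤ × ℤ × ℤ) = n - (-1, 0, -1) := by ext <;> simp
    rw [this, hcpSite_sub_of_odd a h hc, PiLp.sub_apply]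
    ring
  have h5 := p1DispSite_vertex_sub ha hh U b₀ A (n, 0) (m := 1) (m' := 3) (v := n) (w := (n + (1, 0, 1)))
    (by simp [hn, p1VertOff]) (by simp [hn, p1VertOff]) hd5
  have key := fpRec_le_tetMirror a h (p1CellGradT a h U A (n, 0))
  rw [p1Quad_eq_inner h0, p1Quad_eq_inner h1, p1Quad_eq_inner h2, p1Quad_eq_inner h3, p1Quad_eq_inner h4, p1Quad_eq_inner h5] at key
  exact key

/-- **Tetrahedron receipts for the interpolant, ODD cube, piece 1** (vertices `n+(0, 1, 1), n+(1, 1, 1), n+(0, 0, 1), n+(0, 1, 0)`): the cell gradient's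
receipts form is paid by the six edge stretches of the far-ledger field.  NOT a proof of H12⋆, NOT summit progress. -/
theorem p1TetOdd1_receipts {a h : ℝ} (ha : a ≠ 0) (hh : h ≠ 0) (U : ℤ × ℤ × ℤ → (Fin 3 → ℝ)) (b₀ : Fin 3 → ℝ) (A : Fin 3 → Fin 3 → ℝ)
    (n : ℤ × ℤ × ℤ) (hn : p1Par n = false) :
    min (min (a ^ 4) (a ^ 2 * h ^ 2)) (h ^ 4) * fpRec (p1CellGradT a h U A (n, 1)) ≤
      16 * (inner ℝ (hcpSite a h (0, 1, 0)) (p1DispSite a h U b₀ A (n + (0, 1, 1)) - p1DispSite a h U b₀ A (n + (0, 0, 1))) ^ 2 + (inner ℝ (hcpSite a h (0, 1, -1)) (p1DispSite a h U b₀ A (n + (0, 1, 0)) - p1DispSite a h U b₀ A (n + (0, 0, 1))) ^ 2 +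
      (inner ℝ (hcpSite a h (-1, -1, 0)) (p1DispSite a h U b₀ A (n + (0, 0, 1)) - p1DispSite a h U b₀ A (n + (1, 1, 1))) ^ 2 + (inner ℝ (hcpSite a h (0, 0, 1)) (p1DispSite a h U b₀ A (n + (0, 1, 1)) - p1DispSite a h U b₀ A (n + (0, 1, 0))) ^ 2 +
        (inner ℝ (hcpSite a h (-1, 0, 0)) (p1DispSite a h U b₀ A (n + (0, 1, 1)) - p1DispSite a h U b₀ A (n + (1, 1, 1))) ^ 2 + inner ℝ (hcpSite a h (-1, 0, -1)) (p1DispSite a h U b₀ A (n + (0, 1, 0)) - p1DispSite a h U b₀ A (n + (1, 1, 1))) ^ 2))))) := by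
  have hn' : decide (Even n.1) = false := hn
  have hno : Odd n.1 := Int.not_even_iff_odd.1 (of_decide_eq_false hn')
  have hd0 : ∀ k, hcpSite a h (n + (0, 1, 1)) k - hcpSite a h (n + (0, 0, 1)) k = hcpSite a h (0, 1, 0) k := by
    intro k
    have : ((n + (0, 1, 1)) : ℤ × ℤ × ℤ) = (n + (0, 0, 1)) + (0, 1, 0) := by ext <;> simp
    rw [this, hcpSite_add_layer0]
    ring
  have h0 := p1DispSite_vertex_sub ha hh U b₀ A (n, 1) (m := 0) (m' := 2) (v := (n + (0, 1, 1))) (w := (n + (0, 0, 1)))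
    (by simp [hn, p1VertOff]) (by simp [hn, p1VertOff]) hd0
  have hd1 : ∀ k, hcpSite a h (n + (0, 1, 0)) k - hcpSite a h (n + (0, 0, 1)) k = hcpSite a h (0, 1, -1) k := by
    intro k
    have : ((n + (0, 1, 0)) : ℤ × ℤ × ℤ) = (n + (0, 0, 1)) + (0, 1, -1) := by ext <;> simp
    rw [this, hcpSite_add_layer0]
    ring
  have h1 := p1DispSite_vertex_sub ha hh U b₀ A (n, 1) (m := 3) (m' := 2) (v := (n + (0, 1, 0))) (w := (n + (0, 0, 1)))
    (by simp [hn, p1VertOff]) (by simp [hn, p1VertOff]) hd1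
  have hd2 : ∀ k, hcpSite a h (n + (0, 0, 1)) k - hcpSite a h (n + (1, 1, 1)) k = hcpSite a h (-1, -1, 0) k := by
    intro k
    have hc : Odd ((n + (0, 0, 1)) : ℤ × ℤ × ℤ).1 := by show Odd (n.1 + 0); simpa using hno
    have : ((n + (1, 1, 1)) : ℤ × ℤ × ℤ) = (n + (0, 0, 1)) - (-1, -1, 0) := by ext <;> simp
    rw [this, hcpSite_sub_of_odd a h hc, PiLp.sub_apply]
    ring
  have h2 := p1DispSite_vertex_sub ha hh U b₀ A (n, 1) (m := 2) (m' := 1) (v := (n + (0, 0, 1))) (w := (n + (1, 1, 1)))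
    (by simp [hn, p1VertOff]) (by simp [hn, p1VertOff]) hd2
  have hd3 : ∀ k, hcpSite a h (n + (0, 1, 1)) k - hcpSite a h (n + (0, 1, 0)) k = hcpSite a h (0, 0, 1) k := by
    intro k
    have : ((n + (0, 1, 1)) : ℤ × ℤ × ℤ) = (n + (0, 1, 0)) + (0, 0, 1) := by ext <;> simp
    rw [this, hcpSite_add_layer0]
    ring
  have h3 := p1DispSite_vertex_sub ha hh U b₀ A (n, 1) (m := 0) (m' := 3) (v := (n + (0, 1, 1))) (w := (n + (0, 1, 0)))
    (by simp [hn, p1VertOff]) (by simp [hn, p1VertOff]) hd3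
  have hd4 : ∀ k, hcpSite a h (n + (0, 1, 1)) k - hcpSite a h (n + (1, 1, 1)) k = hcpSite a h (-1, 0, 0) k := by
    intro k
    have hc : Odd ((n + (0, 1, 1)) : ℤ × ℤ × ℤ).1 := by show Odd (n.1 + 0); simpa using hno
    have : ((n + (1, 1, 1)) : ℤ × ℤ × ℤ) = (n + (0, 1, 1)) - (-1, 0, 0) := by ext <;> simp
    rw [this, hcpSite_sub_of_odd a h hc, PiLp.sub_apply]
    ring
  have h4 := p1DispSite_vertex_sub ha hh U b₀ A (n, 1) (m := 0) (m' := 1) (v := (n + (0, 1, 1))) (w := (n + (1, 1, 1)))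
    (by simp [hn, p1VertOff]) (by simp [hn, p1VertOff]) hd4
  have hd5 : ∀ k, hcpSite a h (n + (0, 1, 0)) k - hcpSite a h (n + (1, 1, 1)) k = hcpSite a h (-1, 0, -1) k := by
    intro k
    have hc : Odd ((n + (0, 1, 0)) : ℤ × ℤ × ℤ).1 := by show Odd (n.1 + 0); simpa using hno
    have : ((n + (1, 1, 1)) : ℤ × ℤ × ℤ) = (n + (0, 1, 0)) - (-1, 0, -1) := by ext <;> simp
    rw [this, hcpSite_sub_of_odd a h hc, PiLp.sub_apply]
    ring
  have h5 := p1DispSite_vertex_sub ha hh U b₀ A (n, 1) (m := 3) (m' := 1) (v := (n + (0, 1, 0))) (w := (n + (1, 1, 1)))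
    (by simp [hn, p1VertOff]) (by simp [hn, p1VertOff]) hd5
  have key := fpRec_le_tetMirror a h (p1CellGradT a h U A (n, 1))
  rw [p1Quad_eq_inner h0, p1Quad_eq_inner h1, p1Quad_eq_inner h2, p1Quad_eq_inner h3, p1Quad_eq_inner h4, p1Quad_eq_inner h5] at key
  exact key

end Summit.AtomisticToContinuum.Crystallization.Theorems.StrictSplittingRuleBirth
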